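import Literature.MathematicalPhysics.QuantumFieldTheory.Balaban1983to89.B11Rem289KernelColumnsTheta3
import Literature.MathematicalPhysics.QuantumFieldTheory.Balaban1983to89.B9Eq3126H1kPiOneBlockColumn
import Literature.MathematicalPhysics.QuantumFieldTheory.Balaban1983to89.B11Eq44CKernelColumnTower

/-!
# `Balaban1983to89.B11Ineq73KernelLettersLatticeFree` — T. Bałaban, *The variational problem and background fields in renormalization group method for
lattice gauge theories*, Commun. Math. Phys. **102** (1985) 277–309 [Balaban1985Variational], (73) p. 289 + the remark after Prop. 3, (86) p. 291, Prop. 4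
(97)–(98) pp. 292–293 «The constants a₃, C₄ depend on d and L only»; with [Balaban1985Averaging] Prop. 5 (157) p. 42 and [Balaban1985BackgroundPropagators]
(3.126) p. 420, Thm 3.12 p. 423: **THE KERNEL-COLUMN LETTERS `θ_E`, `θ₃` OF THE W-SLOT `W = (δ/δA′)V` ARE LATTICE-FREE ON PRINT's CLASS** — for the chain's pair
`H = H̃_{1,k} = B11Eq103H1Complex.H1LatticeCLM φ hposπ hQ …`, `C = C_k = B11Eq44CLetterTower.Cck …`: `∃ (α₁, j₁, B, δ)` BEFORE the lattice such that the binders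
`hΘE`, `hΘ3` of `B11Eq98CurrentSlot.quadAnalytic_W80` hold with `θ_E = 2ϖΘΓℓ`, `θ₃ = (2ℓ + 1)ϖΘΓ/a_C`, `Θ = M_φBM_φ′·d·K_d(δ)`, `Γ = C₃·2^d·2d`,
`ℓ = (1 − 4bC₂(ε_C + a_C))⁻¹` — NO bond count `κ(∇)`, NO `η⁻¹` (the per-lattice suppliers `B11Ineq73KernelLettersPerLattice` ∕ `…Uniform` pay both)

statement-level skeleton of published theorems with citation tags; proofs where landed; nothing here is a claim about the Yang–Mills mass gap

CITATION HEADER (lean-in-tree rule).  Audit cell `pub-balaban`, sub-cell `t4`, BINDER row NE9; NE9 crux-team LEAF PROVER 01 (`b2b-balaban-t4-ne9-formalise-leaf-01`,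
gen 97; bears_on: R4/N22; ne9-leaf-01 g96 `LOCATED-after-g96.md` §2 (W)(i)).  COMPOSITION BY NAME of this generation's six files, nothing restated:
`B9Eq3126H1kPiOneBlockColumn.exists_oneBlock_letter_H1LatticeCLM` ∕ `sum_fine_exp_block_le` ∕ `sum_fine_weight_exp_block_le` (the one-block letter of `H̃_{1,k}`
and its fine column), `B11Eq44CKernelColumnTower.norm_fderiv_Cck_single_apply_le` + `B7Eq141TorusImagesCount.sum_images_kerQdd_le` ([4] Prop. 5 (157) on the
torus letter `C_k` and its coarse column), `B11Eq73KernelColumnsCarrier.colSum_weighted_kernel_fderiv_Emap_le` (`θ_E`), `B11Rem289KernelColumnsTheta3.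
colSum_weighted_kernel_fderiv_E3_le` (`θ₃`).  Sources read through the audited headers of those files.

WHY LATTICE-FREE.  `H`'s fine column over one block costs the block volume `d·(L^{n+1})^d` ((86): «Σ_{b′∈B_j(y)}»); `C_k`'s coarse column per fine bond is
`C₃·(L^{n+1}η)·2^d·2d·(L^{n+1})^{−d}` (Prop. 5 (157): one fine bond moves the block remainders by `O(η^d)` in total); in the product the volumes CANCEL and
`L^{n+1}η = 1` on the diagonal: `Θ_H·G = (M_φBM_φ′·d·K_d(δ))·(C₃·2^d·2d)`.

WHAT IS PROVED (sorry-free; proof lane — no `def`).  **`exists_thetaE_theta3_latticeFree`**: `∃ α₁ j₁ B δ` (`α₁, j₁, δ > 0`, `B ≥ 0`) BEFORE (K81)'s binder block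
VERBATIM through `hQ` (the data of `H̃_{1,k}`), then for every level profile ∕ carrier data `(lev₀ lev₁ Dc levB)`, [4] Prop. 2's data on `U` and Prop. 5's
radius `ρ′` (the data of `C_k`: `AvgClosed`, (52), `C₀α₀ ≤ 1/3`, `4α₀ ≤ c₂′`, `n + 1 ≤ lev₀`, `e^{4cα₀}(1 + 8C₁ρ′) ≤ 2`, `4ρ′ ≤ c₃`, `2dθ ≤ L³/16`,
`2dC₃ρ′ ≤ 1`), every Sect. C regime `Regime H̃_{1,k} 0 C_k b 0 (C2T d α₀) ρ′ 0 a_C ε_C` with `0 < a_C`, `ε_C + a_C ≤ ρ′`, every weight-ratio bound `ϖ`, and the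
window `(ε_C + a_C)·Θ·Γ ≤ ½`: BOTH kernel-column binders, for every `‖A′‖ < a_C` and every fine bond.
HONEST SCOPE.  (i) The W-slot's remaining letters — `‖J‖₍₋₃₎` ((14)∕(28)), `‖Δ_π‖` ([5] (3.132)), the V₀-group's `C_V` (`B11Eq98V0LettersLatticeUniform`) — and the
assembly of `quadAnalytic_W80` with a lattice-free `(C₄, R′)` are NOT here (next file); the Sect. C regime of `(H̃_{1,k}, C_k)` with lattice-free numerics is the
chart's (`Support/NE9CurChartTowerPiLatticeUniformClass`).  (ii) Constants crude; no decay claimed beyond (K81)'s.  (iii) NOT summit progress (cell pub-balaban: NE9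
NOT PRINTED ∕ NOT PROVED; «NE9 ⇐ the named binders»; row WALLED ON A MODEL (O-NE9-1; #5 UNRULED); spine PROVED 0∕9; rung (B)+1 on a finite T⁴ — NOT infinite
volume, NOT mass gap, NOT BetaPertH, NOT Clay; HONEST DEPENDENCY: continuum YM on T⁴ ⇐ BetaPertH ∧ nine spine estimates (0/9 proved); BetaPertH ⇐ (D1) ∧ (D4) ∧
CAP+tail; G-an2-4 gates asym, D1 and NE2/3/4).  NEW file; imports `B11Rem289KernelColumnsTheta3`, `B9Eq3126H1kPiOneBlockColumn`, `B11Eq44CKernelColumnTower`;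
nothing modified.  Net new unproved facts: 0.
-/

noncomputable section

set_option autoImplicit false

open scoped InnerProductSpace ComplexConjugate BigOperators

namespace Literature.MathematicalPhysics.QuantumFieldTheory.Balaban1983to89.B11Ineq73KernelLettersLatticeFree

open B4Sect5Torus (TSite tdist tdist_nonneg tdist_symm tdist_self tdist_triangle torusSum_le)
open B4Sect5Proof (latticeConst latticeConst_nonneg)
open B9SectCLatticeCarrier (Bond DirPair bpos btgt shift unshift)
open B9Eq311L2Pairing (WL2)
open B9Eq319QprimeTorus (fineP blockCoord)
open B7Prop1Explicit (U1 Wcx boxVec)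
open B11Eq103H1Complex (SiteL2K BondL2K greenK covDerivL2K covDivL2K G1LatticeK KinvLatticeK H1LatticeK H1LatticeK_eq)
open B9Eq310DeltaPrime (plaqHolU)
open B9Eq310HessianOperator (adTransportW hessOp)
open B9Eq310HessianHermitian (adTransportW_adjoint)
open B9Eq315QTorus (perCfg cornerSite)
open B9Eq315QTower (towerP UlevOf)
open B9Eq316TowerFlatIsOneStep (towerP_eq_fineP_pow siteCast)
open B9Eq326OperatorTower (QprimeTowerW QkW RofUk laplaceAk G1k)
open B9Eq324DeltaPrimeATower (laplacePrimeAk GpOfUk)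
open B9Eq33CovDerivLocalLetterTower (tdist_bigBlock_bpos_btgt_le_one)
open B9Eq3117GaugeModeStencilLettersTower (local_hessOp_covDerivL2K_tower local_covDivL2K_hessOp_tower)
open B9Eq3130GtildePairRowsClosedTower (exists_local_letters_G1LatticeKPi)
open B9Eq3132QGtildeQInvLetterClosed (exists_local_letter_KinvLatticeKPi)
open B9Eq3119DeltaPiTower (piOfUk laplaceAkPi)

open B9Eq3126H1kPiSupRowClosed (exists_local_letter_H1LatticeKPi)
open B9Eq326LocalPartTowerSupDecayDiagonalClosed (sum_bondMass_bigBlock_le)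
open B11Eq103H1Complex (H1LatticeCLM H1CLM_apply funEquiv funEquiv_symm_apply)
open B11Eq115Space

open B9Eq3126H1kPiOneBlockColumn (exists_oneBlock_letter_H1LatticeCLM sum_fine_exp_block_le sum_fine_weight_exp_block_le)
open B11Eq103H1Complex (H1LatticeCLM)
open B11Eq115Space
open B11Prop6Scheme (Prop4Hyp)
open B11Eq174Chart (Regime)
open B11Eq90Transpose (kernel single115)
open B11Eq90V0primeCurrent (flat115 flat115_apply)
open B11Eq80Current (Emap E3)
open B11Eq44COperatorTower (C2T)
open B11Eq44CLetterTower (Cck prop4Hyp_Cck)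
open B11Eq44CKernelColumnTower (norm_fderiv_Cck_single_apply_le)
open B7Eq141TorusImagesCount (sum_images_kerQdd_le)
open B7Prop2Explicit (pdev AvgClosed C0 c2')
open B7Prop3Flat (c3)
open B7Prop5GeneralLevels (thetaGen C3Gen)
open B7Prop5GeneralOperators (kerQdd kerQdd_nonneg)
open B9Eq315QTorusOnto (liftSite periodVec)
open B11Eq73KernelColumnsCarrier (colSum_weighted_kernel_fderiv_Emap_le)
open B11Rem289KernelColumnsTheta3 (colSum_weighted_kernel_fderiv_E3_le)

variable {d : ℕ} (hd : 1 ≤ d) (L : ℕ) [NeZero L] (hL : 1 ≤ L) (hL3 : 3 ≤ L)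
  {𝔸 : Type*} [NormedRing 𝔸] [NormedAlgebra ℂ 𝔸] [CompleteSpace 𝔸] [NormOneClass 𝔸] [StarRing 𝔸] [NormedStarGroup 𝔸] [StarModule ℂ 𝔸]
  {W : Type*} [NormedAddCommGroup W] [InnerProductSpace ℂ W] [FiniteDimensional ℂ W] (φ : W ≃ₗ[ℂ] 𝔸)
  {Mφ Mφ' : ℝ} (hMφ : 0 ≤ Mφ) (hMφ' : 0 ≤ Mφ') (hφ : ∀ w, ‖φ w‖ ≤ Mφ * ‖w‖) (hφ' : ∀ X, ‖φ.symm X‖ ≤ Mφ' * ‖X‖) (hstar : ∀ X : 𝔸, ‖star X‖ ≤ ‖X‖)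
  {a : ℝ} (ha : 0 < a) {a' : ℝ} (ha' : 0 < a') {ϱ : ℝ} (hϱ0 : 0 ≤ ϱ) (hϱ1 : ϱ < 1)
  (τ : 𝔸 →ₗ[ℂ] ℂ) {Cτ : ℝ} (hτ : ∀ X, ‖τ X‖ ≤ Cτ * ‖X‖) (hCτ : 0 ≤ Cτ) {Mτ : ℝ} (hτm : ∀ X Y : 𝔸, ‖τ (X * Y)‖ ≤ Mτ * ‖X‖ * ‖Y‖) (hMτ : 0 ≤ Mτ)
  {ρw : ℝ} (hρw : 0 ≤ ρw)
  (hτ₁ : ∀ X : 𝔸, τ (star X) = conj (τ X)) (hτ₂ : ∀ X Y : 𝔸, τ (X * Y) = τ (Y * X)) (hφτ : ∀ X Y : 𝔸, ⟪φ.symm X, φ.symm Y⟫_ℂ = τ (star X * Y))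
  (AQ : ℝ)



set_option maxRecDepth 8192 in
set_option maxHeartbeats 1600000 in -- (K81)'s ≈ 50-binder block + the `C_k` block + the two compositions
include hd hL hL3 hMφ hMφ' hφ hφ' hstar ha ha' hϱ0 hϱ1 hτ hCτ hτm hMτ hρw hτ₁ hτ₂ hφτ in
/-- **`θ_E` AND `θ₃` OF THE W-SLOT `W80` ARE LATTICE-FREE ON PRINT's CLASS** — for the chain's pair `H = H̃_{1,k}` (`B11Eq103H1Complex.H1LatticeCLM φ hposπ hQ …`),
`C = C_k` (`B11Eq44CLetterTower.Cck …`) in a Sect. C regime `Regime H 0 C b 0 C₂ ρ′ 0 a_C ε_C`: `∃ (α₁, j₁, B, δ)` BEFORE the lattice, then for every lattice `(n, η, m)`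
with `ηL^{n+1} = 1`, every background `U` in (K81)'s hypotheses and [4] Prop. 2's regime, every level profile, and every window `(ε_C + a_C ≤ ρ′`,
`(ε_C + a_C)·Θ·Γ ≤ ½)` with the LATTICE-FREE letters `Θ = M_φBM_φ′·d·K_d(δ)`, `Γ = C₃·2^d·2d`: the binders `hΘE`, `hΘ3` of `B11Eq98CurrentSlot.quadAnalytic_W80` hold with
`θ_E = 2ϖΘΓℓ`, `θ₃ = (2ℓ + 1)ϖΘΓ/a_C`, `ℓ = (1 − 4bC₂(ε_C + a_C))⁻¹`, `ϖ` any bound of the `|·|_{(−3)}`-weight ratios — NO bond count, NO `η⁻¹`: the block volume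
`d·L^{(n+1)d}` of `H`'s fine column cancels the `L^{−(n+1)d}` of `C_k`'s coarse column ([4] Prop. 5 (157)), and `L^{n+1}η = 1`.  Composition of this generation's
six files (`B9Eq3126H1kPiOneBlockColumn`, `B7Eq141TorusImagesCount`, `B11Eq44CKernelColumnTower`, `B11Eq73KernelColumnsCarrier`, `B11Rem289KernelColumnsCarrier`,
`B11Rem289KernelColumnsTheta3`). [cite: Balaban1985Variational, (73) p.289, (86) p.291, Prop. 4 (97)–(98) pp.292–293; Balaban1985Averaging, Prop. 5 (157) p.42; Balaban1985BackgroundPropagators, (3.126) p.420, Thm 3.12 p.423] -/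
theorem exists_thetaE_theta3_latticeFree :
    ∃ α₁ j₁ B δ : ℝ, 0 < α₁ ∧ 0 < j₁ ∧ 0 ≤ B ∧ 0 < δ ∧
      ∀ (n : ℕ) (η : ℝ) (_hηL : η * (L : ℝ) ^ (n + 1) = 1) (c₀ c₁ : ℝ) [Fact (0 < c₀)] [Fact (0 < c₁)]
        (_hw : c₀ * ((L : ℝ) ^ (n + 1)) ^ d = c₁) (_hρ : |η| ^ d / c₀ ≤ ρw) (m : Fin d → ℕ) [∀ i, NeZero (m i)] (_hm : ∀ i, 1 ≤ m i)
        (U : Bond d (towerP L m (n + 1)) → 𝔸ˣ) (αU : ℕ → ℝ) (_hα0 : ∀ j, 0 ≤ αU j) (hα1 : ∀ j, αU j ≤ 1 / 64)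
        (hαL : ∀ j, 50 * (d + 1) * αU j * (L : ℝ) ^ d ≤ 1 / 2)
        (hU1 : ∀ (j : ℕ) (x : B7Prop1Explicit.Site d) (k : Fin d), perCfg (towerP L m (j + 1)) (UlevOf L m (n + 1) U j) x k ∈ U1 𝔸)
        (hreg : ∀ (j : ℕ) (y : TSite d (towerP L m j)) (k : Fin d) (ρ' : Fin d → Fin L),
          ‖((Wcx L (perCfg (towerP L m (j + 1)) (UlevOf L m (n + 1) U j)) (cornerSite L y) k (boxVec L ρ') : 𝔸ˣ) : 𝔸) - 1‖ ≤ αU j)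
        (εU : ℕ → ℝ) (_hεU : ∀ j, 0 ≤ εU j) (_hUε : ∀ (j : ℕ) (b : Bond d (towerP L m (j + 1))), ‖(UlevOf L m (n + 1) U j b : 𝔸) - 1‖ ≤ εU j)
        (_hLb : ∀ (j : ℕ) (b : Bond d (towerP L m (j + 1))), UlevOf L m (n + 1) U j b ∈ U1 𝔸)
        (α : ℝ) (_hα : 0 ≤ α) (_hαle : α ≤ α₁)
        (hUst : ∀ b, star (U b : 𝔸) = (((U b)⁻¹ : 𝔸ˣ) : 𝔸)) (_hUb : ∀ b, U b ∈ U1 𝔸) (_hUη : ∀ b, ‖(U b : 𝔸) - 1‖ ≤ α * η)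
        (_hpl : ∀ p : B9SectCLatticeCarrier.Plaq d (towerP L m (n + 1)), ‖(plaqHolU U p : 𝔸) - 1‖ ≤ α * η ^ 2)
        (_hUgrad : ∀ (x : TSite d (towerP L m (n + 1))) (μ : Fin d), ‖(U (x, μ) : 𝔸) - U (unshift μ x, μ)‖ ≤ α * η ^ 2)
        (_hRlev : ∀ (j : ℕ) (b : Bond d (towerP L m (j + 1))) (w : W), ‖adTransportW φ (UlevOf L m (n + 1) U j) b w‖ ≤ ‖w‖)
        (_hεg : ∀ j < n + 1, εU j ≤ α * ϱ ^ j) (_hAQ : ∑ j ∈ Finset.range (n + 1), αU j ≤ AQ)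
        (hpos' : ∀ x : SiteL2K ℂ d (towerP L m (n + 1)) c₀ W, x ≠ 0 → 0 < RCLike.re ⟪x, laplacePrimeAk L m n φ η U a' (c₁ := c₁) x⟫_ℂ)
        (hpos : ∀ x : BondL2K ℂ d (towerP L m (n + 1)) c₀ W, x ≠ 0 →
          0 < RCLike.re ⟪x, laplaceAk L m n φ η U hL αU hα1 hU1 hreg τ (c₀ := c₀) (c₁ := c₁) a x⟫_ℂ)
        (_hc₀η : c₀ = η ^ d) (j₀ : ℝ) (_hJ : ∀ μ y, ‖B9Eq39Adjoint.J (fun μ => B9Eq33CovDerivVector.shiftEquiv μ) (fun μ y => U (y, μ)) η μ y‖ ≤ j₀) (_hj : j₀ ≤ j₁)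
        (hposπ : ∀ x : BondL2K ℂ d (towerP L m (n + 1)) c₀ W, x ≠ 0 →
          0 < RCLike.re ⟪x, laplaceAkPi L m n φ τ η U a' hpos' hL αU hα1 hU1 hreg (c₁ := c₁) a x⟫_ℂ)
        (hQ : Function.Surjective (QkW L m n φ U hL αU hα1 hU1 hreg (c₀ := c₀) (c₁ := c₁)))
        [FiniteDimensional ℂ 𝔸] (lev₀ : Bond d (towerP L m (n + 1)) → ℕ) {κ' : Type*} [Fintype κ'] (lev₁ : κ' → ℕ)
        (Dc : (Bond d (towerP L m (n + 1)) → 𝔸) →ₗ[ℂ] (κ' → 𝔸)) (levB : Bond d m → ℕ) [Fact (0 < (L : ℝ))] [Fact (0 < η)]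
        -- the `C_k`-side data ([4] Prop. 2 on `U`, the levels, the radius `ρ′` of Prop. 5's regime)
        (hL2 : 2 ≤ L) {Gr : Subgroup 𝔸ˣ} (_hGr : AvgClosed d L Gr) (_hUG : ∀ (x : B7Prop1Explicit.Site d) (κ : Fin d), perCfg (towerP L m (n + 1)) U x κ ∈ Gr)
        {α₀ : ℝ} (_hα₀ : 0 < α₀) (_hα3 : C0 d * α₀ ≤ 1 / 3) (_hα4 : 4 * α₀ ≤ c2' d L)
        (_h52 : pdev (perCfg (towerP L m (n + 1)) U) < α₀ * (((L : ℝ) ^ (n + 1))⁻¹) ^ 2) (_hlev : ∀ b, n + 1 ≤ lev₀ b) {ρ' : ℝ}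
        (_hρ' : Real.exp (4 * (800 * ((d : ℝ) + 1) ^ 2 * ((d : ℝ) + 4)) * α₀) * (1 + 8 * (131072 * ((d : ℝ) + 1) ^ 2) * ρ') ≤ 2)
        (_hρ'4 : 4 * ρ' ≤ c3 d L) (_hθ : 2 * d * thetaGen d L α₀ ≤ (L : ℝ) ^ 3 / 16) (_hC3 : 2 * d * C3Gen d L * ρ' ≤ 1)
        -- the Sect. C regime of the pair `(H̃_{1,k}, C_k)` and the window of the kernel route
        {b aC εC : ℝ} (_RC : Regime (H1LatticeCLM (L := (L : ℝ)) (η := η) (lev₀ := lev₀) (levB := levB) φ hposπ hQ lev₁ Dc) 0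
          (Cck L m η (n + 1) U lev₀ lev₁ Dc levB) b 0 (C2T d α₀) ρ' 0 aC εC)
        (_haC : 0 < aC) (_hεa : εC + aC ≤ ρ') {ϖ : ℝ} (_hϖ0 : 0 ≤ ϖ)
        (_hϖ : ∀ bb b' : Bond d (towerP L m (n + 1)), levWeight (L : ℝ) η lev₀ 3 bb / levWeight (L : ℝ) η lev₀ 3 b' ≤ ϖ)
        (_hq : (εC + aC) * (Mφ * B * Mφ' * (d * latticeConst d δ)) * (C3Gen d L * (2 ^ d * (2 * d))) ≤ 1 / 2),
        (∀ A' : Space115 (L : ℝ) η lev₀ lev₁ Dc, ‖A'‖ < aC → ∀ bb : Bond d (towerP L m (n + 1)), ∑ b' : Bond d (towerP L m (n + 1)),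
            levWeight (L : ℝ) η lev₀ 3 bb / levWeight (L : ℝ) η lev₀ 3 b' *
              ‖kernel (fderiv ℂ (Emap (H1LatticeCLM (L := (L : ℝ)) (η := η) (lev₀ := lev₀) (levB := levB) φ hposπ hQ lev₁ Dc)
                (Cck L m η (n + 1) U lev₀ lev₁ Dc levB) εC) A') b' bb‖ ≤
            2 * (ϖ * (Mφ * B * Mφ' * (d * latticeConst d δ))) * (C3Gen d L * (2 ^ d * (2 * d))) * (1 / (1 - 4 * b * C2T d α₀ * (εC + aC))) * ‖A'‖) ∧
        (∀ A' : Space115 (L : ℝ) η lev₀ lev₁ Dc, ‖A'‖ < aC → ∀ bb : Bond d (towerP L m (n + 1)), ∑ b' : Bond d (towerP L m (n + 1)),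
            levWeight (L : ℝ) η lev₀ 3 bb / levWeight (L : ℝ) η lev₀ 3 b' *
              ‖kernel (fderiv ℂ (E3 (H1LatticeCLM (L := (L : ℝ)) (η := η) (lev₀ := lev₀) (levB := levB) φ hposπ hQ lev₁ Dc)
                (Cck L m η (n + 1) U lev₀ lev₁ Dc levB) εC) A') b' bb‖ ≤
            (2 * (1 / (1 - 4 * b * C2T d α₀ * (εC + aC))) + 1) * (ϖ * (Mφ * B * Mφ' * (d * latticeConst d δ))) * (C3Gen d L * (2 ^ d * (2 * d))) / aC *
              ‖A'‖ ^ 2) := by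
  classical
  obtain ⟨α₁, j₁, B, δ, hα₁, hj₁, hB, hδ, HB⟩ :=
    exists_oneBlock_letter_H1LatticeCLM hd L hL hL3 φ hMφ hMφ' hφ hφ' hstar ha ha' hϱ0 hϱ1 τ hτ hCτ hτm hMτ hρw hτ₁ hτ₂ hφτ AQ
  refine ⟨α₁, j₁, B, δ, hα₁, hj₁, hB, hδ, ?_⟩
  intro n η hηL c₀ c₁ _ _ hw hρ m _ hm U αU hα0 hα1 hαL hU1 hreg εU hεU hUε hLb α hα hαle hUst hUb hUη hpl hUgrad hRlev hεg hAQ hpos' hpos hc₀η j₀ hJ hj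
    hposπ hQ _ lev₀ κ' _ lev₁ Dc levB _ _ hL2 Gr hGr hUG α₀ hα₀ hα3 hα4 h52 hlev ρ' hρ' hρ'4 hθ hC3 b aC εC RC haC hεa ϖ hϖ0 hϖ hq
  have hη0 : 0 < η := Fact.out
  have hw3 : ∀ b' : Bond d (towerP L m (n + 1)), 0 < levWeight (L : ℝ) η lev₀ 3 b' := levWeight_pos (Fact.out : 0 < (L : ℝ)) hη0 lev₀ 3
  have hLk : (0 : ℝ) < ((L : ℝ) ^ (n + 1)) ^ d := by positivity
  have hLη : (L : ℝ) ^ (n + 1) * η = 1 := by rw [mul_comm]; exact hηL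
  have hK0 : 0 ≤ latticeConst d δ := latticeConst_nonneg d hδ.le
  have hC30 : 0 ≤ C3Gen d L := by unfold C3Gen B7Prop5GeneralLevels.C1ppGen; positivity
  -- the letters of `H̃_{1,k}`
  set hk : Bond d (towerP L m (n + 1)) → Bond d m → ℝ := fun b' y =>
    Mφ * B * Mφ' * Real.exp (-(δ * tdist m (blockCoord (L ^ (n + 1)) m (siteCast (towerP_eq_fineP_pow L m (n + 1)) (bpos b'))) (bpos y))) with hhk
  have hk0 : ∀ b' y, 0 ≤ hk b' y := fun b' y => by rw [hhk]; positivity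
  have hHk : ∀ (y : Bond d m) (Z : 𝔸) (b' : Bond d (towerP L m (n + 1))),
      ‖flat115 (H1LatticeCLM (L := (L : ℝ)) (η := η) (lev₀ := lev₀) (levB := levB) φ hposπ hQ lev₁ Dc
        ((NegSup.equiv (levWeight (L : ℝ) η levB 0) 𝔸).symm (Pi.single y Z))) b'‖ ≤ hk b' y * ‖Z‖ := fun y Z b' => by
    rw [flat115_apply]
    exact HB n η hηL c₀ c₁ hw hρ m hm U αU hα0 hα1 hαL hU1 hreg εU hεU hUε hLb α hα hαle hUst hUb hUη hpl hUgrad hRlev hεg hAQ hpos' hpos hc₀η j₀ hJ hj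
      hposπ hQ lev₀ lev₁ Dc levB y Z b'
  set ΘH : ℝ := Mφ * B * Mφ' * (d * ((L : ℝ) ^ (n + 1)) ^ d * latticeConst d δ) with hΘH
  have hΘH0 : 0 ≤ ΘH := by rw [hΘH]; positivity
  have hH1 : ∀ y, ∑ b', hk b' y ≤ ΘH := fun y => by
    rw [hΘH, hhk]
    simp only []
    rw [← Finset.mul_sum]
    exact mul_le_mul_of_nonneg_left (sum_fine_exp_block_le L n m hm hδ (bpos y)) (by positivity)
  have hHw : ∀ (bb : Bond d (towerP L m (n + 1))) (y : Bond d m), ∑ b', levWeight (L : ℝ) η lev₀ 3 bb / levWeight (L : ℝ) η lev₀ 3 b' * hk b' y ≤ ϖ * ΘH := by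
    intro bb y
    rw [hΘH, hhk]
    simp only []
    have h := sum_fine_weight_exp_block_le hd L n m hm hδ (bpos y) (r := fun b' => levWeight (L : ℝ) η lev₀ 3 bb / levWeight (L : ℝ) η lev₀ 3 b' * (Mφ * B * Mφ'))
      (ϖ := ϖ * (Mφ * B * Mφ')) (fun b' => mul_nonneg (div_nonneg (hw3 bb).le (hw3 b').le) (by positivity))
      (fun b' => mul_le_mul_of_nonneg_right (hϖ bb b') (by positivity))
    calc _ = ∑ b', levWeight (L : ℝ) η lev₀ 3 bb / levWeight (L : ℝ) η lev₀ 3 b' * (Mφ * B * Mφ') *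
          Real.exp (-(δ * tdist m (blockCoord (L ^ (n + 1)) m (siteCast (towerP_eq_fineP_pow L m (n + 1)) (bpos b'))) (bpos y))) :=
          Finset.sum_congr rfl fun b' _ => by ring
      _ ≤ _ := h
      _ = _ := by ring
  -- the letters of `C_k`
  set gC : Bond d m → Bond d (towerP L m (n + 1)) → ℝ := fun c bb =>
    C3Gen d L * ∑ t ∈ (Fintype.piFinset fun _ : Fin d => ({0, 1} : Finset ℤ)),
      kerQdd L (n + 1) (liftSite c.1) c.2 (liftSite bb.1 + periodVec (towerP L m (n + 1)) t) bb.2 with hgC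
  have hgC0 : ∀ c bb, 0 ≤ gC c bb := fun c bb => by
    rw [hgC]
    exact mul_nonneg hC30 (Finset.sum_nonneg fun t _ => kerQdd_nonneg L (n + 1) (liftSite c.1) c.2 _ bb.2)
  have hCg : ∀ A : Space115 (L : ℝ) η lev₀ lev₁ Dc, ‖A‖ < εC + aC → ∀ (bb : Bond d (towerP L m (n + 1))) (X : 𝔸) (c : Bond d m),
      ‖NegSup.equiv (levWeight (L : ℝ) η levB 0) 𝔸 (fderiv ℂ (Cck L m η (n + 1) U lev₀ lev₁ Dc levB) A (single115 (lev₁ := lev₁) (Dc := Dc) bb X)) c‖ ≤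
        gC c bb * ‖A‖ * ‖X‖ := by
    intro A hA bb X c
    have h := norm_fderiv_Cck_single_apply_le L m η (n + 1) U lev₀ lev₁ Dc levB hL2 hGr hUG hα₀ hα3 hα4 h52 hlev hρ' hρ'4 hθ hC3 (lt_of_lt_of_le hA hεa) bb X c
    rw [hLη, mul_one] at h
    refine h.trans (le_of_eq ?_)
    rw [hgC]
    simp only []
    ring
  set G : ℝ := C3Gen d L * (2 ^ d * (2 * d) * (((L : ℝ) ^ (n + 1)) ^ d)⁻¹) with hGdef
  have hG : ∀ bb, ∑ c, gC c bb ≤ G := fun bb => by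
    rw [hGdef, hgC]
    simp only []
    rw [← Finset.mul_sum]
    exact mul_le_mul_of_nonneg_left (sum_images_kerQdd_le L m (n + 1) (le_trans (by norm_num) hL2) bb) hC30
  -- the product of the two letters is lattice-free
  have hprod : ΘH * G = (Mφ * B * Mφ' * (d * latticeConst d δ)) * (C3Gen d L * (2 ^ d * (2 * d))) := by
    rw [hΘH, hGdef]; field_simp
  have hq' : (εC + aC) * ΘH * G ≤ 1 / 2 := by rw [mul_assoc, hprod, ← mul_assoc]; exact hq
  have hC : Prop4Hyp (Cck L m η (n + 1) U lev₀ lev₁ Dc levB) (C2T d α₀) ρ' :=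
    prop4Hyp_Cck L m η (n + 1) U lev₀ lev₁ Dc levB hL2 hGr hUG hα₀ hα3 hα4 h52 hlev hρ' (by linarith [RC.ε₄_nonneg])
  refine ⟨fun A' hA' bb => ?_, fun A' hA' bb => ?_⟩
  · have h := colSum_weighted_kernel_fderiv_Emap_le RC hC hk0 hHk hH1 hgC0 hCg hG hq' hΘH0 (by positivity) hHw hA' bb
    refine h.trans (le_of_eq ?_)
    linear_combination (2 * ϖ * (1 / (1 - 4 * b * C2T d α₀ * (εC + aC))) * ‖A'‖) * hprod
  · have h := colSum_weighted_kernel_fderiv_E3_le RC hC haC hk0 hHk hΘH0 hH1 (by positivity) hHw hgC0 hCg hG hq' hA' bb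
    refine h.trans (le_of_eq ?_)
    linear_combination ((2 * (1 / (1 - 4 * b * C2T d α₀ * (εC + aC))) + 1) * ϖ / aC * ‖A'‖ ^ 2) * hprod

end Literature.MathematicalPhysics.QuantumFieldTheory.Balaban1983to89.B11Ineq73KernelLettersLatticeFree

end
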